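import Literature.NumberTheory.Rogawski1990.ExplicitFactorContinuousAtMatchingPair        -- ★ p835442 F4 + ★ F2B `finKappaAt_eventually_eq`, `continuous_finGammaTwo`, `continuous_finTauArg`, `continuous_eval_finCharpolyTwo`
import Literature.NumberTheory.Automorphic.LocalRingUnitsCharacterLocallyConstant        -- G1: continuous `ℂˣ`-characters of `(Π E_w)^×` are locally constant
import HarnessLib

/-!
# Rogawski's explicit finite-place factor `Δ‴_v` is EVENTUALLY CONSTANT along the matching pairs near a `(G,H)`-regular matching pair: `τ_v`, `D_{G∕H,v}` and
# `κ_v` are each locally constant there (Rogawski (1990) Prop. 8.1.3 proof p. 116, «for `t` sufficiently close to `1`»)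

Topic `NumberTheory/Rogawski1990`; namespace `Literature.NumberTheory.Rogawski1990`.  THEOREMS ONLY (no definition, no named fact, no instance, no notation,
no `sorry`; net debt 0).  Cell `pub/hodgecm-mathlib`, F0∕P3a, topic T6 (#88 side, road letter «D-G4♭-lc» of `SIZING-S1prime` §2∕§5, LEAD T6-51): the
`p`-ADIC SHARPENING of ★ `continuousOn_finExplicitDelta` (F2B, «continuous») to «EVENTUALLY CONSTANT» — the form the germ expansion of Prop. 8.1.3 uses
(«Δ(γ_H δ_t, γ δ_t) = Δ_{G∕H}(γ₀)·κ for `t` close to `1`»).  Mathlib-only footing; count-neutral for the books.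

THE MATHEMATICS (finite `v` of `L⁺`, `E_v = Π_{w∣v} L_w`).  `μ_v` = ★ `finHeckeValue μ` agrees on the open units with the continuous character `μ.semilocalComponent`
of `(E_v)^×` (★ `continuous_semilocalComponent`), which is LOCALLY CONSTANT (★ G1 `eventually_apply_eq_of_continuous`: `ℂˣ` has no small subgroups, `E_v^×` has
small open subgroups) ⇒ `μ_v` is constant near every unit (§1).  `u = γ₂` and `−χ_g(u)·det g⁻¹` are continuous in `γ_H` and units where `χ_g(u)` is (★
`isUnit_finGammaTwo`, ★ `isUnit_finTauArg_of_isUnit`) ⇒ `τ_v = μ_v(u)·μ_v(−χ_g(u)∕det g)⁻¹` is constant near such `γ_H` (§2).  `‖·‖_w` is constant near every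
non-zero point (Mathlib `Valued.locally_const`, `Valued.toNormedField.norm_le_iff`) ⇒ `D_{G∕H,v} = (Π_w ‖χ_g(u)_w‖_w)^{1∕2}` is constant near `γ_H` with `χ_g(u)` a
unit (§3).  With ★ `finKappaAt_eventually_eq` (F2B): on a matching pair with `χ_g(u)` a unit, `Δ‴_v = τ_v·D·κ_v` takes the SAME VALUE at every nearby matching
pair (§4, HEAD `finExplicitDelta_eventually_eq`), in particular at the localisations `((γ_H)_v, γ_v)` of a rational `(G,H)`-regular pair `γ_H → γ` (print's
singular `γ₀ ∈ M`; F4's naming scheme).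

* §1 **`finHeckeValue_eventually_eq`** (at units).
* §2 **`finTau_eventually_eq`** (at `γ_H` with `χ_g(u)` a unit).
* §3 (private `norm_eventually_eq_of_ne_zero`: `‖·‖_w` constant near `x ≠ 0`), **`finWeylRatio_eventually_eq`**.
* §4 HEAD **`finExplicitDelta_eventually_eq`**, `finExplicitDelta_eventuallyEq_nhdsWithin` (`=ᶠ[𝓝[matching locus] (γ_H, γ′)]` a constant),
  **`finExplicitDelta_eventually_eq_rationalComponent`**, `finExplicitDelta_eventually_eq_rationalComponent_toLocal`.

HONEST LABEL: HC_CM is proved only modulo the printed citations (named inputs remaining 2) until rung 0 closes; this file proves none of them.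

## References
* [Rogawski1990] J. D. Rogawski, *Automorphic Representations of Unitary Groups in Three Variables*, Ann. of Math. Stud. 123 (1990): Prop. 8.1.3 and its proof
  p. 116 (the transfer factor along `γ_H δ_t` for `t` close to `1`), §4.9 p. 55 (`τ`, `D_{G∕H}`, `Δ_{G∕H}`), §14.6 p. 242.
* [TateThesis1967] J. Tate, *Fourier analysis in number fields and Hecke's zeta-functions* (1950∕1967), §2.3 (local quasi-characters are trivial near `1`).
* [LanglandsShelstad1987] R. P. Langlands, D. Shelstad, *On the definition of transfer factors*, Math. Ann. 278 (1987), Lemma 4.1.A.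
-/

set_option autoImplicit false

noncomputable section

open NumberField IsDedekindDomain Matrix Polynomial Filter Topology
open scoped MatrixGroups

namespace Literature.NumberTheory.Rogawski1990

open Literature.NumberTheory.Automorphic
open Literature.NumberTheory.GaloisRepresentations

section Place

variable (L : Type) [Field L] [NumberField L] [IsCMField L] (v : HeightOneSpectrum (𝓞 ↥(maximalRealSubfield L)))

/-! ## §1 `μ_v` is locally constant on the units -/

omit [IsCMField L] in
/-- **`μ_v` IS CONSTANT NEAR EVERY UNIT of `E_v`**: ★ `finHeckeValue μ` agrees on units with the continuous character ★ `μ.semilocalComponent v` of `(E_v)^×`, which is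
locally constant (★ `eventually_apply_eq_of_continuous`). [cite: Rogawski1990, §4.9 p. 55] [cite: TateThesis1967, §2.3] -/
theorem finHeckeValue_eventually_eq (μ : HeckeCharacter L) {x : UnitaryGroup.LocalRing L v} (hx : IsUnit x) :
    ∀ᶠ y in 𝓝 x, finHeckeValue L v μ y = finHeckeValue L v μ x :=
  UnitaryGroup.eventually_eq_of_eq_apply_unit_of_locallyConstant L v
    (g := fun u : (UnitaryGroup.LocalRing L v)ˣ => ((μ.semilocalComponent L v u : ℂˣ) : ℂ))
    (fun u₀ => by
      filter_upwards [UnitaryGroup.eventually_apply_eq_of_continuous L v (μ.semilocalComponent L v)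
        (UnitaryGroup.continuous_semilocalComponent L μ) u₀] with u hu
      rw [hu])
    (fun _ hy => finHeckeValue_of_isUnit L v μ hy) hx

/-! ## §2 `τ_v` is locally constant where `χ_g(u)` is a unit -/

/-- **`τ_v(γ_H) = μ_v(u)·μ_v(−χ_g(u)∕det g)⁻¹` IS CONSTANT NEAR every `γ_H` with `χ_g(u)` a unit** (`u`, `−χ_g(u)·det g⁻¹` continuous ★ `continuous_finGammaTwo`, ★
`continuous_finTauArg`, and units there ★ `isUnit_finGammaTwo`, ★ `isUnit_finTauArg_of_isUnit`). [cite: Rogawski1990, §4.9 p. 55; Prop. 8.1.3 proof p. 116] -/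
theorem finTau_eventually_eq (μ : HeckeCharacter L)
    {a₀ : (UnitaryGroup.cmDatum L 2 (Matrix.of fun i j : Fin 2 => if i.val + j.val + 1 = 2 then (1 : L) else 0)).Local v ×
      (UnitaryGroup.cmDatum L 1 (Matrix.of fun i j : Fin 1 => if i.val + j.val + 1 = 1 then (1 : L) else 0)).Local v}
    (hu₀ : IsUnit ((finCharpolyTwo L v a₀).eval (finGammaTwo L v a₀))) :
    ∀ᶠ a in 𝓝 a₀, finTau L v a μ = finTau L v a₀ μ := by
  have h1 := ((continuous_finGammaTwo L v).tendsto a₀).eventually (finHeckeValue_eventually_eq L v μ (isUnit_finGammaTwo L v a₀))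
  have h2 := ((continuous_finTauArg L v).tendsto a₀).eventually (finHeckeValue_eventually_eq L v μ (isUnit_finTauArg_of_isUnit L v a₀ hu₀))
  filter_upwards [h1, h2] with a ha1 ha2
  unfold finTau
  rw [ha1, ha2]

/-! ## §3 `D_{G∕H,v}` is locally constant where `χ_g(u)` is a unit -/

omit [IsCMField L] in
/-- **The normalised absolute value of a completion `L_w` is constant near every non-zero point** (Mathlib `Valued.locally_const`; the norm is a monotone function
of the valuation, `Valued.toNormedField.norm_le_iff`). [folklore] -/
private theorem norm_eventually_eq_of_ne_zero (w : HeightOneSpectrum (𝓞 L)) {x : w.adicCompletion L} (hx : x ≠ 0) :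
    ∀ᶠ y in 𝓝 x, ‖y‖ = ‖x‖ := by
  have hv : (Valued.v x : WithZero (Multiplicative ℤ)) ≠ 0 := (Valuation.ne_zero_iff _).2 hx
  filter_upwards [Valued.locally_const hv] with y hy
  refine le_antisymm ?_ ?_
  · rw [Valued.toNormedField.norm_le_iff]; exact hy.le
  · rw [Valued.toNormedField.norm_le_iff]; exact hy.ge

/-- **`D_{G∕H,v}(γ_H) = (Π_w ‖χ_g(u)_w‖_w)^{1∕2}` IS CONSTANT NEAR every `γ_H` with `χ_g(u)` a unit** (each `χ_g(u)_w ≠ 0` and continuous in `γ_H`, ★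
`continuous_eval_finCharpolyTwo`). [cite: Rogawski1990, §4.9 p. 55; Prop. 8.1.3 proof p. 116] -/
theorem finWeylRatio_eventually_eq
    {a₀ : (UnitaryGroup.cmDatum L 2 (Matrix.of fun i j : Fin 2 => if i.val + j.val + 1 = 2 then (1 : L) else 0)).Local v ×
      (UnitaryGroup.cmDatum L 1 (Matrix.of fun i j : Fin 1 => if i.val + j.val + 1 = 1 then (1 : L) else 0)).Local v}
    (hu₀ : IsUnit ((finCharpolyTwo L v a₀).eval (finGammaTwo L v a₀))) :
    ∀ᶠ a in 𝓝 a₀, finWeylRatio L v a = finWeylRatio L v a₀ := by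
  have hw : ∀ w : UnitaryGroup.PlacesOver L v, ∀ᶠ a in 𝓝 a₀,
      ‖(finCharpolyTwo L v a).eval (finGammaTwo L v a) w‖ = ‖(finCharpolyTwo L v a₀).eval (finGammaTwo L v a₀) w‖ := fun w => by
    have hne : (finCharpolyTwo L v a₀).eval (finGammaTwo L v a₀) w ≠ 0 := ((Pi.isUnit_iff.1 hu₀) w).ne_zero
    exact (((continuous_apply w).comp (continuous_eval_finCharpolyTwo L v)).tendsto a₀).eventually (norm_eventually_eq_of_ne_zero L w.1 hne)
  filter_upwards [eventually_all.2 hw] with a ha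
  unfold finWeylRatio
  rw [Finset.prod_congr rfl fun w _ => ha w]

/-! ## §4 HEAD: `Δ‴_v` is eventually constant along the matching pairs -/

variable (H' : Matrix (Fin 3) (Fin 3) L)

open scoped Classical in
/-- **ROGAWSKI'S EXPLICIT FINITE-PLACE FACTOR IS EVENTUALLY CONSTANT ALONG THE MATCHING PAIRS**: at a finite `v`, for hermitian `H′` with `det H′ ≠ 0`, any Hecke
character `μ`, and a matching pair `ι_v(γ_H) ↔ γ′` with `χ_g(u)` a unit (`γ′` possibly `G`-singular), every NEARBY matching pair `(γ_H¹, γ′¹)` has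
`Δ‴_v(γ_H¹, γ′¹) = Δ‴_v(γ_H, γ′)` — `τ_v`, `D_{G∕H,v}` (§2–§3) and `κ_v` (★ `finKappaAt_eventually_eq`) are all locally constant there.  Print: in the proof of Prop.
8.1.3 the factor `Δ(γ_H δ_t, γ δ_t)` is constant for `t` close to `1`. [cite: Rogawski1990, Prop. 8.1.3 proof p. 116; §4.9 p. 55; §14.6 p. 242] [cite: LanglandsShelstad1987, Lemma 4.1.A] -/
theorem finExplicitDelta_eventually_eq (hH : (H'.map (cmConjRingHom L))ᵀ = H') (hdet : H'.det ≠ 0) (μ : HeckeCharacter L)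
    {a₀ : (UnitaryGroup.cmDatum L 2 (Matrix.of fun i j : Fin 2 => if i.val + j.val + 1 = 2 then (1 : L) else 0)).Local v ×
      (UnitaryGroup.cmDatum L 1 (Matrix.of fun i j : Fin 1 => if i.val + j.val + 1 = 1 then (1 : L) else 0)).Local v}
    {b₀ : (UnitaryGroup.cmDatum L 3 H').Local v} (h₀ : IsLocalNormPair L H' v a₀ b₀)
    (hu₀ : IsUnit ((finCharpolyTwo L v a₀).eval (finGammaTwo L v a₀))) :
    ∀ᶠ q in 𝓝 (a₀, b₀), IsLocalNormPair L H' v q.1 q.2 → finExplicitDelta L v H' q.1 μ q.2 = finExplicitDelta L v H' a₀ μ b₀ := by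
  have hτ := (continuous_fst.tendsto (a₀, b₀)).eventually (finTau_eventually_eq L v μ hu₀)
  have hD := (continuous_fst.tendsto (a₀, b₀)).eventually (finWeylRatio_eventually_eq L v hu₀)
  filter_upwards [hτ, hD, finKappaAt_eventually_eq L v H' hH hdet h₀ hu₀] with q hqτ hqD hqκ hmatch
  rw [finExplicitDelta_of_isLocalNormPair L v H' q.1 μ hmatch, finExplicitDelta_of_isLocalNormPair L v H' a₀ μ h₀, hqτ, hqD, hqκ hmatch]

open scoped Classical in
/-- The same as an `EventuallyEq` within the matching locus: `Δ‴_v =ᶠ[𝓝[matching pairs] (γ_H, γ′)] Δ‴_v(γ_H, γ′)`. [cite: Rogawski1990, Prop. 8.1.3 proof p. 116] -/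
theorem finExplicitDelta_eventuallyEq_nhdsWithin (hH : (H'.map (cmConjRingHom L))ᵀ = H') (hdet : H'.det ≠ 0) (μ : HeckeCharacter L)
    {a₀ : (UnitaryGroup.cmDatum L 2 (Matrix.of fun i j : Fin 2 => if i.val + j.val + 1 = 2 then (1 : L) else 0)).Local v ×
      (UnitaryGroup.cmDatum L 1 (Matrix.of fun i j : Fin 1 => if i.val + j.val + 1 = 1 then (1 : L) else 0)).Local v}
    {b₀ : (UnitaryGroup.cmDatum L 3 H').Local v} (h₀ : IsLocalNormPair L H' v a₀ b₀)
    (hu₀ : IsUnit ((finCharpolyTwo L v a₀).eval (finGammaTwo L v a₀))) :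
    (fun q : ((UnitaryGroup.cmDatum L 2 (Matrix.of fun i j : Fin 2 => if i.val + j.val + 1 = 2 then (1 : L) else 0)).Local v ×
        (UnitaryGroup.cmDatum L 1 (Matrix.of fun i j : Fin 1 => if i.val + j.val + 1 = 1 then (1 : L) else 0)).Local v) ×
        (UnitaryGroup.cmDatum L 3 H').Local v => finExplicitDelta L v H' q.1 μ q.2) =ᶠ[𝓝[{q | IsLocalNormPair L H' v q.1 q.2}] (a₀, b₀)]
      fun _ => finExplicitDelta L v H' a₀ μ b₀ := by
  rw [EventuallyEq, eventually_nhdsWithin_iff]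
  exact finExplicitDelta_eventually_eq L v H' hH hdet μ h₀ hu₀

variable (γH : (UnitaryGroup.cmDatum L 2 (Matrix.of fun i j : Fin 2 => if i.val + j.val + 1 = 2 then (1 : L) else 0)).Rational ×
    (UnitaryGroup.cmDatum L 1 (Matrix.of fun i j : Fin 1 => if i.val + j.val + 1 = 1 then (1 : L) else 0)).Rational)

open scoped Classical in
/-- **At a RATIONAL `γ_H` with `χ_g(u) ≠ 0` in `L`** (possibly `G`-singular — print's `γ₀ ∈ M`) and any local `γ′` matching `(γ_H)_v`: `Δ‴_v` is eventually constant
along the matching pairs near `((γ_H)_v, γ′)` (★ `isUnit_eval_finCharpolyTwo_rationalComponent_of_eval_ne_zero`). [cite: Rogawski1990, Prop. 8.1.3 proof p. 116; Prop. 8.2.1 (a) p. 118] -/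
theorem finExplicitDelta_eventually_eq_rationalComponent (hH : (H'.map (cmConjRingHom L))ᵀ = H') (hdet : H'.det ≠ 0) (μ : HeckeCharacter L)
    (hχ : ((γH.1.val.val : Matrix (Fin 2) (Fin 2) L).charpoly).eval ((γH.2.val.val : Matrix (Fin 1) (Fin 1) L) 0 0) ≠ 0)
    {b : (UnitaryGroup.cmDatum L 3 H').Local v} (hb : IsLocalNormPair L H' v (rationalComponent L γH v) b) :
    ∀ᶠ q in 𝓝 (rationalComponent L γH v, b),
      IsLocalNormPair L H' v q.1 q.2 → finExplicitDelta L v H' q.1 μ q.2 = finExplicitDelta L v H' (rationalComponent L γH v) μ b :=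
  finExplicitDelta_eventually_eq L v H' hH hdet μ hb (isUnit_eval_finCharpolyTwo_rationalComponent_of_eval_ne_zero L γH hχ v)

open scoped Classical in
/-- **The same at the localisation `((γ_H)_v, γ_v)` of a rational matching pair `γ_H → γ`** (★ `isLocalNormPair_rationalComponent_toLocal_toAdelic`).
[cite: Rogawski1990, Prop. 8.1.3 proof p. 116; Prop. 8.2.1 (a) p. 118] -/
theorem finExplicitDelta_eventually_eq_rationalComponent_toLocal (hH : (H'.map (cmConjRingHom L))ᵀ = H') (hdet : H'.det ≠ 0) (μ : HeckeCharacter L)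
    (hχ : ((γH.1.val.val : Matrix (Fin 2) (Fin 2) L).charpoly).eval ((γH.2.val.val : Matrix (Fin 1) (Fin 1) L) 0 0) ≠ 0)
    {γ : (UnitaryGroup.cmDatum L 3 H').Rational} (hγ : IsNormPair L H' γH γ) :
    ∀ᶠ q in 𝓝 (rationalComponent L γH v, (UnitaryGroup.cmDatum L 3 H').toLocal v ((UnitaryGroup.cmDatum L 3 H').toAdelic γ)),
      IsLocalNormPair L H' v q.1 q.2 →
        finExplicitDelta L v H' q.1 μ q.2 =
          finExplicitDelta L v H' (rationalComponent L γH v) μ ((UnitaryGroup.cmDatum L 3 H').toLocal v ((UnitaryGroup.cmDatum L 3 H').toAdelic γ)) :=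
  finExplicitDelta_eventually_eq_rationalComponent L v H' γH hH hdet μ hχ (isLocalNormPair_rationalComponent_toLocal_toAdelic hγ v)

end Place

end Literature.NumberTheory.Rogawski1990

end
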